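import Literature.AlgebraicGeometry.Deformation.VectorFieldFirstOrderFlow
import Literature.AlgebraicGeometry.AbelianSchemes.VectorFieldFlowIsTranslation
import Literature.AlgebraicGeometry.AbelianSchemes.FirstOrderTranslateClassOfDlogCoboundary
import Literature.AlgebraicGeometry.AbelianSchemes.FirstOrderFlowTrivialOfKOfLUnramified
import HarnessLib

/-!
# `φ_L : Lie(A) → Ȟ¹(𝔘, 𝒪_A)` is injective (algebraic, characteristic `0`)
# (Mumford, *Abelian Varieties* §13, proof of the Theorem; Görtz–Wedhorn II, Prop. 27.122 / Rem. 27.18 (4))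

Layer `Literature/AlgebraicGeometry/AbelianSchemes`, namespace `Literature.AlgebraicGeometry.AbelianSchemes.AbelianSchemeOver`.
THEOREMS ONLY (no definition, no named fact, no instance, no notation, no `sorry`).  Cell `hodgecm-mathlib` (D-0151), F-11
α1-(iii-c-2) «`φ_{L_s}` onto `Ȟ¹(𝒪)`», WAVE-4 ask (W4-2) (I2-a) of F0P1b-plan (g0) (R23): THE LETTER
`socket_I2a_eq_zero_of_contracted_dlog_coboundary` of F0P1b-p03 (g0)'s `SOCKETS-I2.v0` :95, VERBATIM, assembled from the four
files of the seam `SOCKETS-I2a-seam.v0` (B-p08 (g16) / B-p06 (g15)):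

* (α) ★ `Deformation/VectorFieldFirstOrderFlow` (B-p08): the FIRST-ORDER FLOW `Φ_D : A ⊗ Spec k[ε] ⟶ A` of a global vector
  field `D` — identity on the closed fibre, underlying map of the projection `p`, section formula `Φ♯ f = p♯ f + t · p♯(D(df))`;
* (β) ★ `AbelianSchemes/VectorFieldFlowIsTranslation` (B-p08): on an abelian scheme a deformation of the identity over an Artin
  base is the TRANSLATION by its value `u_D = (e, 𝟙) ≫ Φ_D` at the origin ([MumfordFogartyKirwan1994] Cor. 6.2);
* (γ) ★ `AbelianSchemes/FirstOrderTranslateClassOfDlogCoboundary` (B-p06): if the contracted `dlog`-cocycle `g_{jl}⁻¹ · D(dg_{jl})`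
  of a framed rank-one `L` is a Čech coboundary, then `Φ_D^*[L] = p^*[L]` in `Ȟ¹(A[ε], 𝒪^×)`;
* (δ-core) ★ `AbelianSchemes/FirstOrderFlowTrivialOfKOfLUnramified` (B-p06): then `u_D ∈ K(L)(k[ε])`, and `K(L)` FINITE and
  FORMALLY UNRAMIFIED over `Spec k` for `L` rigidified and fibrewise of an ample class in characteristic `0`
  (★ `exists_kOfL_formallyUnramified`) forces `u_D = e`, `Φ_D = p`, `D = 0`.

So: **`AbelianSchemeOver.vectorField_eq_zero_of_contracted_dlog_coboundary`** — for an abelian scheme `A` over a field `k` of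
characteristic `0`, `L` of rank one rigidified along the unit section (`hε`) and geometrically of the class of an ample divisor
(`hΘ`), framed by `F` on a finite affine open cover `U`, and a global vector field `D : Ω¹_{A/k}|_⊤ → 𝒪_A|_⊤`: IF
`g_{jl}⁻¹ · D(dg_{jl}) = h_l| − h_j|` for a `0`-cochain `h`, THEN `D = 0`.  I.e. the `k`-linear map `D ↦ [g⁻¹ · ι_D dg]`,
`H⁰(A, 𝒯_A) → Ȟ¹(𝔘, 𝒪_A)` — the tangent map at `e` of `x ↦ t_x^*L ⊗ L⁻¹` — is INJECTIVE.

HC_CM is proved only modulo the 7 printed citations until rung 0 closes; this file is generic abelian-scheme geometry and asserts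
nothing about HC.

## References
* [MumfordAV1970] D. Mumford, *Abelian Varieties* (1970), §13, proof of the Theorem (pp. 125–130).
* [GortzWedhorn2023] U. Görtz, T. Wedhorn, *Algebraic Geometry II* (2023), Prop. 27.122 and Rem. 27.18 (4).
* [MumfordFogartyKirwan1994] D. Mumford, J. Fogarty, F. Kirwan, *Geometric Invariant Theory*, 3rd ed. (1994), Ch. 6 §1 Cor. 6.2 (p. 116).
-/

noncomputable section

open CategoryTheory CategoryTheory.Limits AlgebraicGeometry Opposite TopologicalSpace MonoidalCategory
  CartesianMonoidalCategory

namespace Literature.AlgebraicGeometry.AbelianSchemes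

open Literature.AlgebraicGeometry.Motives Literature.AlgebraicGeometry.Modules
  Literature.AlgebraicGeometry.Morphisms Literature.AlgebraicGeometry.HodgeTheory Literature.AlgebraicGeometry.Deformation

/-- **`φ_L` IS INJECTIVE (algebraic, characteristic `0`)** — the (I2-a) letter `socket_I2a_eq_zero_of_contracted_dlog_coboundary`
of `SOCKETS-I2.v0` :95, binder for binder.  `A` an abelian scheme over a field `k` of characteristic `0`, `L` of rank one,
rigidified (`hε`) and geometrically of the class of an ample divisor (`hΘ`), presented on a finite affine open cover `U` by frames
`F` (`g_{jl} = F.tf j l`, `g_{jl}⁻¹ = F.tfOn l j _`); `D` a global vector field.  IF the contracted `dlog`-cocycle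
`g_{jl}⁻¹ · D(dg_{jl})` is a Čech coboundary `h_l| − h_j|`, THEN `D = 0`.  Proof: the flow `Φ_D` of `D` ((α)) is the translation by
`u_D` ((β)); `Φ_D^*[L] = p^*[L]` ((γ)); hence `u_D ∈ K(L)(k[ε])`, `K(L)` is unramified, `u_D = e`, `Φ_D = p`, `D = 0` ((δ)-core).
[cite: MumfordAV1970, §13, proof of the Theorem (pp. 125–130)] [cite: GortzWedhorn2023, Prop. 27.122 and Rem. 27.18 (4)]
[cite: MumfordFogartyKirwan1994, Ch. 6 §1 Cor. 6.2 (p. 116)] -/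
theorem AbelianSchemeOver.vectorField_eq_zero_of_contracted_dlog_coboundary {k : Type} [Field k] [CharZero k]
    (A : AbelianSchemeOver (Spec (.of k))) {L : A.left.Modules} (hL : HasRank L 1)
    (hε : CechPic.pullback A.unitSection (detClass (HasRank.isFiniteLocallyFree' hL)) = 1)
    (hΘ : ∀ ⦃Ω : Type⦄ [Field Ω] [IsAlgClosed Ω] (s : Spec (.of Ω) ⟶ Spec (.of k)),
      ∃ Θ : CartierDivisor (A.fibre s).toAbelianVariety.X.left, Θ.IsAmple ∧
        CechPic.pullback (X := (A.fibre s).toAbelianVariety.X.left) (pullback.fst A.X.hom s)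
          (detClass (HasRank.isFiniteLocallyFree' hL)) = Θ.cechClass)
    {ι : Type} [Finite ι] (U : ι → A.X.left.affineOpens) (hcov : ⨆ j, (U j).1 = ⊤)
    (F : IFrames L (fun j => (U j).1))
    (D : (cotangentSheaf A.X).over ⊤ ⟶ (unitModule A.X.left).over ⊤)
    (h : (j : ι) → Γ(A.X.left, (U j).1))
    (hD : ∀ j l : ι,
      F.tfOn l j ((U j).1 ⊓ (U l).1) inf_le_right inf_le_left *
          (show Γ(A.X.left, (U j).1 ⊓ (U l).1) from
            appLE D (homOfLE le_top) (dSection A.X ((U j).1 ⊓ (U l).1) (F.tf j l))) =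
        A.X.left.presheaf.map (homOfLE (inf_le_right : (U j).1 ⊓ (U l).1 ≤ (U l).1)).op (h l) -
          A.X.left.presheaf.map (homOfLE (inf_le_left : (U j).1 ⊓ (U l).1 ≤ (U j).1)).op (h j)) :
    D = 0 := by
  obtain ⟨Φ, h0, hb, happ⟩ := Deformation.exists_firstOrderFlow A.X D
  exact vectorField_eq_zero_of_flow_of_cechPic_pullback_eq A hL hε hΘ D Φ h0 happ
    (A.whiskerLeft_comp_mul_eq_of_closedFibreι_comp_eq_id _ Φ h0)
    (cechPic_pullback_flow_eq_of_contracted_dlog_coboundary_of_vectorField A.X hL U hcov F D Φ hb happ h hD)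

/-- **Kernel form**: under the same hypotheses, two global vector fields whose contracted `dlog`-cocycles differ by a Čech
coboundary are EQUAL (the map `D ↦ [g⁻¹ · ι_D dg]`, `H⁰(A, 𝒯_A) → Ȟ¹(𝔘, 𝒪_A)`, is injective; additivity of `D ↦ D(dg)`).
[cite: MumfordAV1970, §13, proof of the Theorem (pp. 125–130)] [cite: GortzWedhorn2023, Prop. 27.122 and Rem. 27.18 (4)] -/
theorem AbelianSchemeOver.vectorField_eq_of_contracted_dlog_sub_coboundary {k : Type} [Field k] [CharZero k]
    (A : AbelianSchemeOver (Spec (.of k))) {L : A.left.Modules} (hL : HasRank L 1)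
    (hε : CechPic.pullback A.unitSection (detClass (HasRank.isFiniteLocallyFree' hL)) = 1)
    (hΘ : ∀ ⦃Ω : Type⦄ [Field Ω] [IsAlgClosed Ω] (s : Spec (.of Ω) ⟶ Spec (.of k)),
      ∃ Θ : CartierDivisor (A.fibre s).toAbelianVariety.X.left, Θ.IsAmple ∧
        CechPic.pullback (X := (A.fibre s).toAbelianVariety.X.left) (pullback.fst A.X.hom s)
          (detClass (HasRank.isFiniteLocallyFree' hL)) = Θ.cechClass)
    {ι : Type} [Finite ι] (U : ι → A.X.left.affineOpens) (hcov : ⨆ j, (U j).1 = ⊤)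
    (F : IFrames L (fun j => (U j).1))
    (D D' : (cotangentSheaf A.X).over ⊤ ⟶ (unitModule A.X.left).over ⊤)
    (h : (j : ι) → Γ(A.X.left, (U j).1))
    (hD : ∀ j l : ι,
      F.tfOn l j ((U j).1 ⊓ (U l).1) inf_le_right inf_le_left *
          (show Γ(A.X.left, (U j).1 ⊓ (U l).1) from
            appLE D (homOfLE le_top) (dSection A.X ((U j).1 ⊓ (U l).1) (F.tf j l))) -
        F.tfOn l j ((U j).1 ⊓ (U l).1) inf_le_right inf_le_left *
          (show Γ(A.X.left, (U j).1 ⊓ (U l).1) from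
            appLE D' (homOfLE le_top) (dSection A.X ((U j).1 ⊓ (U l).1) (F.tf j l))) =
        A.X.left.presheaf.map (homOfLE (inf_le_right : (U j).1 ⊓ (U l).1 ≤ (U l).1)).op (h l) -
          A.X.left.presheaf.map (homOfLE (inf_le_left : (U j).1 ⊓ (U l).1 ≤ (U j).1)).op (h j)) :
    D = D' := by
  rw [← sub_eq_zero]
  refine A.vectorField_eq_zero_of_contracted_dlog_coboundary hL hε hΘ U hcov F (D - D') h fun j l => ?_
  rw [← hD j l, ← mul_sub]
  rfl

end Literature.AlgebraicGeometry.AbelianSchemes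

end
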